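import Summits.BirchSwinnertonDyer.BirchSwinnertonDyer.Theorems.AlignedTransportAtTwoBSDOfMainConjectureRankOneAtTwoSigmaSqTwoFieldIsogenyCalculus
import HarnessLib

/-!
# The SQUARED `2`-isogeny functional equation of the Mazur–Tate sigma function (two curves, any `p`):
# `z²·σ'(ψz)² = π²·σ(z)⁴·(X − e z²)`, i.e. `Σ'(ψP) = π²·Σ(P)²·(x(P) − x(Q))` — step S5 of the discharge plan
# for the PRINT stub `stub_sigmaSqTwo` of crux C3′ (route-independent)

Cell `bsd-f1-sign2`, WIDTH-5 attach seat `bsd-line-att-p3` g8 (`--supports stmt-BirchSwinnertonDyer-23008`). THEOREMS ONLY; BSD is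
not proved by any of this; the PRINT fact `mazurTate_sigmaSq_existsUnique_two` is NOT discharged here. FIELD-GENERAL RE-ISSUE (any field
`F` of characteristic `0`, namespace `….SigmaSqTwo.Field`) of `…SigmaSqTwoIsogenyFE.lean` (stated over `ℚ_p` only): the universal Dwork
argument (plan S6/§7) runs the functional equation in `Frac(R̂₂)⟦z⟧ ⊇ K₂⟦z⟧`, so the field-general form is the one needed; proofs verbatim.

Setting. `V, V'` Weierstrass curves over `F`; `σ = z + ⋯` a normalised ODD formal solution of Mazur–Tate's equation
`x + c = −D(Dσ/σ)` on `V`, `σ'` the same on `V'` with constant `c'`; `T ∈ zF⟦z⟧` with `log_{V'}(T) = π·log_V` (`π ≠ 0`;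
e.g. `T = ψ*z'` for an isogeny `ψ : V → V'` with `ψ*ω' = πω`); `(e, ·)` a `2`-torsion point of `V` (`4e³ + b₂e² + 2b₄e + b₆ = 0`,
`2t = 6e² + b₂e + b₄`); and the `x`-relation of the degree-`2` isogeny with kernel `{O, (e,·)}` followed by an isomorphism onto
`V'`: `π²·x'(T) = x + t/(x − e) + r₀` (Vélu), poles cleared. THEN, provided the constants satisfy
**`r₀ + π²c' − 2c − e = 0`**, one has **`z²·σ'(T)² = π²·σ⁴·(X − e z²)`** (`X = z²x`): the SQUARE of «`σ'(ψP)/σ(P)²` is the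
function with divisor `(Q) − (O)`» — which at degree `2` is not a function, while its square `π²(x − x(Q))` is («everything
squared», Silverman 2005 §5 Rem. 2; Perrin-Riou 1984 III §1.2 for the CM endomorphism case = the tree's
`X_sq_mul_sq_subst_eq_of_cmTwoIsogeny`, of which this is the two-curve generalisation: there `V' = V`, `c' = c`).

Why it matters (plan `Cruxes/BSDOfMainConjectureRankOneAtTwo/SIGMASQ-AT-TWO-att-p3.md`, S5–S6): for the quotient `ψ : E → E' = E/μ₂`
by the `ℚ₂`-rational canonical subgroup at an ordinary `2`, in the Frobenius-compatible model (`π = 2`, `T ≡ z² (mod 2)`), this reads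
`H'(T) = H²·V` with `H = σ²/z²`, `H' = σ'²/z²`, `V = 4z⁴(x − e)/T² ∈ 1 + 4zℤ₂⟦z⟧` — exactly the input shape of the tree's Dwork lemma
`Literature.RingTheory.FormalGroups.coeff_mem_of_map_subst_eq_pow_mul` (exponent `p = 2`), once run over the universal `a₁`-chart
with its Frobenius lift. The constant relation is the residue of Blakestad–Grant's Prop. 13(a) (pinned by their step 1 + Lemma 4);
numerically `v₂(r₀ + 4c' − 2c − e) ≥ 7` on 53a1, 61a1, 79a1, 433a1 (seat recon).

* `X_sq_mul_sq_subst_eq_of_twoIsogeny` — the functional equation for `σ, σ'`;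
* `sq_subst_mul_X_sq_eq_of_twoIsogeny` — the same for the squares `Σ = σ²`, `Σ' = σ'²`: `Σ'(T)·z² = π²·Σ²·(X − ez²)`.

## Sources
* B. Perrin-Riou, Mém. SMF 17 (1984), Ch. III §1.2 (`σ(αz)/σ(z)^{Nα} = g_α`). [cite: Perrinriou1984, Ch. III §1.2 Lemme 3 (ii)]
* J. H. Silverman, Math. Ann. 332 (2005), §5 Rem. 2. [cite: Silverman2005DivPoly, §5 Rem. 2]
* C. Blakestad, D. Grant, J. Number Theory 249 (2023), Prop. 13. [cite: BlakestadGrant2023, Prop. 13]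
* B. Mazur, J. Tate, Duke Math. J. 62 (1991), §3. [cite: MazurTate1991, Thm. 3.1]
* J. Vélu, C. R. Acad. Sci. Paris 273 (1971). [cite: SilvermanAEC2009, III.4]
-/

noncomputable section

set_option linter.dupNamespace false
set_option autoImplicit false

open scoped Classical
open PowerSeries WeierstrassCurve Literature.NumberTheory.EllipticCurves

namespace Summit.BirchSwinnertonDyer.BirchSwinnertonDyer.Theorems.AlignedTransportAtTwoSigmaSqTwo.Field

variable {F : Type*} [Field F] [CharZero F] (V V' : WeierstrassCurve F)

/-- **The squared `2`-isogeny functional equation of the sigma function (two curves).** With the notation of the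
module docstring: `σ` on `V` (constant `c`), `σ'` on `V'` (constant `c'`), `log_{V'}(T) = π log_V`, `π ≠ 0`, `(e,·) ∈ V[2]`,
`2t = 6e² + b₂e + b₄`, the pole-cleared `x`-relation `π²·X'(T)·z²(X − ez²) = T²·(X(X − ez²) + tz⁴ + r₀z²(X − ez²))`, and
`r₀ + π²c' − 2c − e = 0`. Then `z²·σ'(T)² = π²·σ⁴·(X − ez²)`. Proof: both sides have the same second logarithmic derivative
along `D = d/ω_V` (`N(σ'∘T) = π²N'(σ')∘T`, the two sigma equations, `−(log(x − e))'' = −2(x − e) + 2t/(x − e)`; the defect is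
the constant `2(r₀ + π²c' − 2c − e) = 0`) and the same `2`-jet `π²z⁴(1 + a₁z + ⋯)`; rigidity. [cite: Perrinriou1984, Ch. III §1.2
Lemme 3 (ii)] [cite: BlakestadGrant2023, Prop. 13] [cite: Silverman2005DivPoly, §5 Rem. 2] -/
theorem X_sq_mul_sq_subst_eq_of_twoIsogeny {σ σ' T : F⟦X⟧} {c c' π e t r₀ : F}
    (hσ0 : constantCoeff σ = 0) (hσ1 : coeff 1 σ = 1) (hodd : V.IsFormallyOdd σ) (hODE : V.SatisfiesSigmaODE σ c)
    (hσ0' : constantCoeff σ' = 0) (hσ1' : coeff 1 σ' = 1) (hodd' : V'.IsFormallyOdd σ')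
    (hODE' : V'.SatisfiesSigmaODE σ' c') (hT0 : constantCoeff T = 0)
    (hlog : V'.formalLog.subst T = C π * V.formalLog) (hπ : π ≠ 0)
    (he : 4 * e ^ 3 + V.b₂ * e ^ 2 + 2 * V.b₄ * e + V.b₆ = 0) (ht : 2 * t = 6 * e ^ 2 + V.b₂ * e + V.b₄)
    (hx : C π ^ 2 * V'.formalXMulSq.subst T * (X ^ 2 * (V.formalXMulSq - C e * X ^ 2)) =
      T ^ 2 * (V.formalXMulSq * (V.formalXMulSq - C e * X ^ 2) + C t * X ^ 4 +
        C r₀ * X ^ 2 * (V.formalXMulSq - C e * X ^ 2)))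
    (hκ : r₀ + π ^ 2 * c' - 2 * c - e = 0) :
    X ^ 2 * σ'.subst T ^ 2 = C π ^ 2 * σ ^ 4 * (V.formalXMulSq - C e * X ^ 2) := by
  have hs : HasSubst T := HasSubst.of_constantCoeff_zero' hT0
  set D := V.formalInvariantDerivation with hD
  set D' := V'.formalInvariantDerivation with hD'
  set Xs := V.formalXMulSq with hXs
  set A := V.formalXMulSq - C e * X ^ 2 with hA
  set η := V.formalEta with hη
  set κX := X * D η - η ^ 2 with hκX
  set σT := σ'.subst T with hσT
  set XsT := V'.formalXMulSq.subst T with hXsT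
  obtain ⟨hσT0, hσT1, hσT2⟩ := coeff_sigma_subst_two V V' hσ0' hσ1' hodd' hT0 hlog
  have hT1 := coeff_one_of_formalLog_subst_two V V' hT0 hlog
  have hσ2 := V.two_mul_coeff_two_of_isFormallyOdd hodd hσ0 hσ1
  -- ratio data
  have rdσ : X ^ 2 * logDeriv₂Num D σ = -(Xs + C c * X ^ 2) * σ ^ 2 :=
    V.X_sq_mul_logDeriv₂Num_of_satisfiesSigmaODE hσ0 hσ1 hODE
  have rdσ' : X ^ 2 * logDeriv₂Num D' σ' = -(V'.formalXMulSq + C c' * X ^ 2) * σ' ^ 2 :=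
    V'.X_sq_mul_logDeriv₂Num_of_satisfiesSigmaODE hσ0' hσ1' hODE'
  have rdσT : logDeriv₂Num D σT * T ^ 2 = (-(C π ^ 2 * (XsT + C c' * T ^ 2))) * σT ^ 2 := by
    have e := congrArg (PowerSeries.subst T) rdσ'
    rw [subst_mul hs, subst_pow hs, subst_X hs, subst_mul hs, ← coe_substAlgHom hs, map_neg, map_add,
      map_mul, map_pow, coe_substAlgHom hs, C_subst_eq c', subst_X hs, subst_pow hs] at e
    rw [hσT, logDeriv₂Num_subst_two V V' hT0 hlog]
    change C π ^ 2 * (logDeriv₂Num D' σ').subst T * T ^ 2 = -(C π ^ 2 * (XsT + C c' * T ^ 2)) * σ'.subst T ^ 2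
    linear_combination C π ^ 2 * e
  have rd1 : logDeriv₂Num D (σT ^ 2) * T ^ 2 = (-2 * (C π ^ 2 * (XsT + C c' * T ^ 2))) * (σT ^ 2) ^ 2 := by
    rw [logDeriv₂Num_sq]; linear_combination 2 * σT ^ 2 * rdσT
  have rdX2 : logDeriv₂Num D (X ^ 2) * X ^ 2 = (2 * κX) * (X ^ 2) ^ 2 :=
    (two_mul_kappa_mul_X_pow_eq_logDeriv₂Num_X_sq V).symm
  have rdF := logDeriv₂Num_mul_ratio D rdX2 rd1
  have rdσ4 : logDeriv₂Num D (C π ^ 2 * σ ^ 4) * X ^ 2 = (-4 * (Xs + C c * X ^ 2)) * (C π ^ 2 * σ ^ 4) ^ 2 := by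
    have hC : D (C π ^ 2) = 0 := by rw [← map_pow, hD, formalInvariantDerivation_C]
    rw [logDeriv₂Num_const_mul D hC, show σ ^ 4 = (σ ^ 2) ^ 2 by ring, logDeriv₂Num_sq, logDeriv₂Num_sq]
    linear_combination (4 * C π ^ 4 * σ ^ 6) * rdσ
  have rdA : logDeriv₂Num D A * (X ^ 2 * A) = (2 * κX * A + 2 * A ^ 2 - 2 * C t * X ^ 4) * A ^ 2 := by
    have h := X_sq_mul_logDeriv₂Num_formalXMulSq_sub V he ht
    rw [← hA, ← hD, ← hη, ← hκX] at h
    linear_combination A * h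
  have rdG := logDeriv₂Num_mul_ratio D rdσ4 rdA
  -- the two second logarithmic derivatives agree: the defect is `2(r₀ + π²c' − 2c − e)·(…) = 0`
  have hκC : (C r₀ : F⟦X⟧) + C π ^ 2 * C c' - 2 * C c - C e = 0 := by
    have := congrArg (C (R := F)) hκ
    simpa only [map_add, map_sub, map_mul, map_pow, map_ofNat, map_zero] using this
  have hagree : (2 * κX * T ^ 2 + -2 * (C π ^ 2 * (XsT + C c' * T ^ 2)) * X ^ 2) * (X ^ 2 * (X ^ 2 * A)) =
      (-4 * (Xs + C c * X ^ 2) * (X ^ 2 * A) + (2 * κX * A + 2 * A ^ 2 - 2 * C t * X ^ 4) * X ^ 2) *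
        (X ^ 2 * T ^ 2) := by
    rw [hA] at hx ⊢
    linear_combination (-2 * X ^ 4) * hx + (-2 * X ^ 6 * (Xs - C e * X ^ 2) * T ^ 2) * hκC
  -- hence `N(F)·G² = N(G)·F²`
  set F := X ^ 2 * σT ^ 2 with hF
  set G := C π ^ 2 * σ ^ 4 * A with hG
  have hTne : T ≠ 0 := fun h => by rw [h, map_zero] at hT1; exact hπ hT1.symm
  have hAne : A ≠ 0 := fun h => by
    have := congrArg constantCoeff h
    rw [hA, map_sub, map_mul, map_pow, constantCoeff_X, constantCoeff_formalXMulSq, map_zero] at this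
    norm_num at this
  have hNN : logDeriv₂Num D F * G ^ 2 = logDeriv₂Num D G * F ^ 2 := by
    have hd : (X ^ 2 * T ^ 2) * (X ^ 2 * (X ^ 2 * A)) ≠ 0 :=
      mul_ne_zero (mul_ne_zero (pow_ne_zero _ X_ne_zero) (pow_ne_zero _ hTne))
        (mul_ne_zero (pow_ne_zero _ X_ne_zero) (mul_ne_zero (pow_ne_zero _ X_ne_zero) hAne))
    have e : (logDeriv₂Num D F * G ^ 2 - logDeriv₂Num D G * F ^ 2) *
        ((X ^ 2 * T ^ 2) * (X ^ 2 * (X ^ 2 * A))) = 0 := by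
      rw [hF, hG]
      linear_combination (G ^ 2 * (X ^ 2 * (X ^ 2 * A))) * rdF - (F ^ 2 * (X ^ 2 * T ^ 2)) * rdG +
        (F ^ 2 * G ^ 2) * hagree
    exact sub_eq_zero.mp ((mul_eq_zero.mp e).resolve_right hd)
  -- leading data: `F = z⁴·f₀`, `G = z⁴·g₀`
  set sT := sigmaShift σT with hsT
  set s := sigmaShift σ with hss
  have hXsT : X * sT = σT := X_mul_sigmaShift hσT0
  have hXs' : X * s = σ := X_mul_sigmaShift hσ0
  have hsT0 : constantCoeff sT = π := by rw [hsT, constantCoeff_sigmaShift, hσT1]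
  have hs0 : constantCoeff s = 1 := by rw [hss, constantCoeff_sigmaShift, hσ1]
  have hsT1 : 2 * coeff 1 sT = V.a₁ * π := by rw [hsT, coeff_sigmaShift]; exact hσT2
  have hs1 : 2 * coeff 1 s = V.a₁ := by rw [hss, coeff_sigmaShift]; exact hσ2
  have hA0 : constantCoeff A = 1 := by
    rw [hA, map_sub, map_mul, map_pow, constantCoeff_X, constantCoeff_formalXMulSq]; norm_num
  have hA1 : coeff 1 A = -V.a₁ := by
    rw [hA, map_sub, coeff_one_formalXMulSq, coeff_C_mul, coeff_X_pow, if_neg (by norm_num)]; ring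
  have hFf : F = X ^ 4 * sT ^ 2 := by rw [hF, ← hXsT]; ring
  have hGg : G = X ^ 4 * (C π ^ 2 * s ^ 4 * A) := by rw [hG, ← hXs']; ring
  have key : sT ^ 2 = C π ^ 2 * s ^ 4 * A := by
    refine eq_of_logDeriv₂Num_X_pow_mul_eq V 4 ?_ ?_ ?_ (by rw [← hFf, ← hGg]; exact hNN)
    · rw [map_pow, hsT0, map_mul, map_mul, ← map_pow C, constantCoeff_C, map_pow, hs0, hA0]; ring
    · rw [map_mul, map_mul, ← map_pow C, constantCoeff_C, map_pow, hs0, hA0, one_pow, mul_one, mul_one]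
      exact pow_ne_zero _ hπ
    · have l1 : coeff 1 (sT ^ 2) = 2 * constantCoeff sT * coeff 1 sT := by
        rw [sq, coeff_one_mul_eq, coeff_zero_eq_constantCoeff_apply]; ring
      have l2 : coeff 1 (s ^ 4) = 4 * coeff 1 s := by
        have e2 : coeff 1 (s ^ 2) = 2 * coeff 1 s := by
          rw [sq, coeff_one_mul_eq, coeff_zero_eq_constantCoeff_apply, hs0]; ring
        have e20 : constantCoeff (s ^ 2) = 1 := by rw [map_pow, hs0, one_pow]
        rw [show s ^ 4 = s ^ 2 * s ^ 2 by ring, coeff_one_mul_eq, coeff_zero_eq_constantCoeff_apply, e20, e2]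
        ring
      have l3 : coeff 1 (C π ^ 2 * s ^ 4 * A) = π ^ 2 * (4 * coeff 1 s + coeff 1 A) := by
        rw [← map_pow, mul_assoc, coeff_C_mul, coeff_one_mul_eq, coeff_zero_eq_constantCoeff_apply,
          map_pow, hs0, one_pow, one_mul, coeff_zero_eq_constantCoeff_apply, hA0, mul_one, l2]
        ring
      rw [l1, l3, hsT0, hA1]
      linear_combination π * hsT1 - 2 * π ^ 2 * hs1
  calc X ^ 2 * σT ^ 2 = X ^ 4 * sT ^ 2 := hFf
    _ = X ^ 4 * (C π ^ 2 * s ^ 4 * A) := by rw [key]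
    _ = C π ^ 2 * σ ^ 4 * A := hGg.symm

/-- **The same in sigma-SQUARED currency**: for `Σ = σ²`, `Σ' = σ'²` (the objects that are `2`-integral at an ordinary `2`):
`Σ'(T)·z² = π²·Σ²·(X − ez²)`, i.e. `Σ'(ψz) = π²·Σ(z)²·(x(z) − e)` — for the quotient by the canonical subgroup at `2` in its
Frobenius-compatible model (`π = 2`, `T ≡ z² (mod 2)`): `H'(T) = H²·V`, `H = Σ/z²`, `V = 4z⁴(x − e)/T²`, Dwork's input.
[cite: Silverman2005DivPoly, §5 Rem. 2] [cite: BlakestadGrant2023, Prop. 13] -/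
theorem sq_subst_mul_X_sq_eq_of_twoIsogeny {σ σ' T : F⟦X⟧} {c c' π e t r₀ : F}
    (hσ0 : constantCoeff σ = 0) (hσ1 : coeff 1 σ = 1) (hodd : V.IsFormallyOdd σ) (hODE : V.SatisfiesSigmaODE σ c)
    (hσ0' : constantCoeff σ' = 0) (hσ1' : coeff 1 σ' = 1) (hodd' : V'.IsFormallyOdd σ')
    (hODE' : V'.SatisfiesSigmaODE σ' c') (hT0 : constantCoeff T = 0)
    (hlog : V'.formalLog.subst T = C π * V.formalLog) (hπ : π ≠ 0)
    (he : 4 * e ^ 3 + V.b₂ * e ^ 2 + 2 * V.b₄ * e + V.b₆ = 0) (ht : 2 * t = 6 * e ^ 2 + V.b₂ * e + V.b₄)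
    (hx : C π ^ 2 * V'.formalXMulSq.subst T * (X ^ 2 * (V.formalXMulSq - C e * X ^ 2)) =
      T ^ 2 * (V.formalXMulSq * (V.formalXMulSq - C e * X ^ 2) + C t * X ^ 4 +
        C r₀ * X ^ 2 * (V.formalXMulSq - C e * X ^ 2)))
    (hκ : r₀ + π ^ 2 * c' - 2 * c - e = 0) :
    (σ' ^ 2).subst T * X ^ 2 = C π ^ 2 * (σ ^ 2) ^ 2 * (V.formalXMulSq - C e * X ^ 2) := by
  have hs : HasSubst T := HasSubst.of_constantCoeff_zero' hT0
  have h := X_sq_mul_sq_subst_eq_of_twoIsogeny V V' hσ0 hσ1 hodd hODE hσ0' hσ1' hodd' hODE' hT0 hlog hπ he ht hx hκ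
  rw [subst_pow hs]
  linear_combination h

end Summit.BirchSwinnertonDyer.BirchSwinnertonDyer.Theorems.AlignedTransportAtTwoSigmaSqTwo.Field
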